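import Literature.Geometry.Riemannian.HeatKernelFullSupport
import HarnessLib

/-!
# Bamler's gradient estimate for indicator data: `Φ⁻¹ ∘ ν_{·,t;s}(X)` is `(t − s)^{-1/2}`-Lipschitz
# (Bamler 2020a, Thm. 4.1 / Prop. 4.2 (4.7); Bamler 2023, Def. 3.2 (6))

R. Bamler, *Entropy and heat kernel bounds on a Ricci flow background*, arXiv:2008.07093 (2020a),
Thm. 4.1 (the improved gradient estimate `|∇Φ⁻¹(u_t)| ≤ (t − s)^{-1/2}` for heat solutions
`u : M × [s, t] → (0, 1)`), applied — as in the proof of Prop. 4.2, (4.7), `∫_X q dν ≤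
Φ'(Φ⁻¹(ν(X)))` — to the INDICATOR `𝟙_X` of a Borel set `X`: for the conjugate heat kernel
measures `ν_{x,t;s}` (`heatKernelMeasure`, `HeatKernelMeasures.lean`) of a `C^∞` family `h` of
Riemannian metrics on a closed connected manifold `M` (modelled on `ℝᵐ`) which is a Ricci flow,
the function `x ↦ Φ⁻¹(ν_{x,t;s}(X))` is `(t − s)^{-1/2}`-Lipschitz for the Riemannian distance
`d_{h(t)}` (`PseudoRiemannianMetric.edist`, extended form: points at infinite distance impose
nothing), provided `X` and `Xᶜ` both have positive `V_{h(s)}`-volume (so that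
`0 < ν_{x,t;s}(X) < 1` and `Φ⁻¹` is evaluated inside `(0, 1)`):

* `IsRicciFlow.heatKernelMeasure_real_mem_Ioo` — **`0 < ν_{x,t;s}(X) < 1`** for a flow on
  `[s, t]`, `s < t`, when `V_{h(s)}(X) > 0` and `V_{h(s)}(Xᶜ) > 0` (full support of the heat
  kernel measures, `IsRicciFlow.heatKernelMeasure_pos_of_riemVolume_pos`,
  `HeatKernelFullSupport.lean`);
* `IsRicciFlow.ofReal_abs_PhiInv_heatKernelMeasure_real_sub_le` — **the Lipschitz bound**
  `|Φ⁻¹(ν_{x,t;s}(X)) − Φ⁻¹(ν_{x',t;s}(X))| ≤ (t − s)^{-1/2} d_{h(t)}(x, x')` for a flow on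
  `[s, t]` (the gradient property for bounded measurable data,
  `IsRicciFlow.integral_heatKernelMeasure_const_or_eq_Phi` of
  `HeatKernelGradientPropertyZero.lean` — i.e. Thm. 4.1 with `T = 0` passed from smooth to
  measurable data — for the datum `𝟙_X`, whose propagation `ν_{·,t;s}(X)` is either constant or
  `Φ ∘ f'` with `f'` `(t − s)^{-1/2}`-Lipschitz);
* `ofReal_abs_PhiInv_heatKernelMeasure_sub_le` — the same two facts packaged for a Ricci flow on
  `[a, T]` and times `a < s < t ≤ T` (the form consumed downstream, next to the heat kernel
  function `K(x,t;y,s)` of `RicciFlowHeatKernelFn.lean`).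

Everything is proved; no definitions, no named facts. What is NOT here: the integrated form
(4.7) `∫_X |∇ₓK(x,t;·,s)| dg_s ≤ (t − s)^{-1/2} Φ'(Φ⁻¹(ν_{x,t;s}(X)))` of Bamler 2020a, Prop. 4.2
(which differentiates the present Lipschitz bound along curves), general measurable data
`u : M → [0, 1]` (see `HeatKernelGradientPropertyZero.lean`), and non-compact or disconnected `M`
(on a disconnected `M` the indicator of a component is propagated to itself and the bound fails).

## References

* R. H. Bamler, *Entropy and heat kernel bounds on a Ricci flow background*, arXiv:2008.07093
  (2020), §4.1, Thm. 4.1; §4.3, Prop. 4.2, (4.7). [Bamler2020Entropy]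
* R. H. Bamler, *Compactness theory of the space of super Ricci flows*, Invent. Math. 233 (2023),
  1121–1277, §3.1 Def. 3.2 (6), §3.7. [Bamler2023]
-/

noncomputable section

open Bundle Set Function Filter Manifold MeasureTheory Measure TopologicalSpace
open scoped Manifold ContDiff Topology ENNReal NNReal

namespace Literature.Geometry.Riemannian

open Lorentzian Lorentzian.PseudoRiemannianMetric MetricFlow

section IndicatorData

variable {m : ℕ} {H : Type*} [TopologicalSpace H]
  {I : ModelWithCorners ℝ (EuclideanSpace ℝ (Fin m)) H} [I.Boundaryless]
  {M : Type*} [TopologicalSpace M] [ChartedSpace H M] [IsManifold I ∞ M]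
  [T2Space M] [CompactSpace M] [SecondCountableTopology M] [MeasurableSpace M] [BorelSpace M]
  [PreconnectedSpace M]
  {h : ℝ → PseudoRiemannianMetric I ∞ (EuclideanSpace ℝ (Fin m)) (TangentSpace I : M → Type _)}
  {cov : ℝ → CovariantDerivative I (EuclideanSpace ℝ (Fin m)) (TangentSpace I : M → Type _)}
  (hh : IsContMDiffFamilyOn ∞ h univ) (hR : ∀ r, (h r).IsRiemannian)

/-- **`0 < ν_{x,t;s}(X) < 1` when `X` and `Xᶜ` have positive volume** (Bamler 2020a, §2.3: the
heat kernel is positive, so `ν_{x,t;s}` charges every set of positive `V_{h(s)}`-volume): for a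
`C^∞` family of Riemannian metrics on a closed connected `M` which is a Ricci flow on `[s, t]`,
`s < t`, and a Borel set `X` with `V_{h(s)}(X) > 0`, `V_{h(s)}(Xᶜ) > 0`, the real number
`ν_{x,t;s}(X)` lies in `(0, 1)` for every `x` (`ν_{x,t;s}(X) > 0`, `ν_{x,t;s}(Xᶜ) > 0`, total
mass one). [cite: Bamler2020Entropy, §2.3] -/
theorem IsRicciFlow.heatKernelMeasure_real_mem_Ioo {s t : ℝ} (hst : s < t)
    (hflow : IsRicciFlow h cov (Icc s t)) {X : Set M} (hX : MeasurableSet X)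
    (hXpos : 0 < (h s).riemVolume X) (hXcpos : 0 < (h s).riemVolume Xᶜ) (x : M) :
    (heatKernelMeasure hh hR t x s).real X ∈ Ioo (0 : ℝ) 1 := by
  have h1 := hflow.heatKernelMeasure_pos_of_riemVolume_pos hh hR hst hX hXpos x
  have h2 := hflow.heatKernelMeasure_pos_of_riemVolume_pos hh hR hst hX.compl hXcpos x
  have h3 : 0 < (heatKernelMeasure hh hR t x s).real Xᶜ :=
    ENNReal.toReal_pos h2.ne' (measure_ne_top _ _)
  have h4 := measureReal_add_measureReal_compl (μ := heatKernelMeasure hh hR t x s) hX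
  rw [probReal_univ] at h4
  exact ⟨ENNReal.toReal_pos h1.ne' (measure_ne_top _ _), by linarith⟩

/-- **Bamler's gradient estimate for indicator data, Lipschitz form** (Bamler 2020a, Thm. 4.1
with `T = 0` for the datum `𝟙_X`, as used in the proof of Prop. 4.2, (4.7); Bamler 2023,
Def. 3.2 (6)): for a `C^∞` family of Riemannian metrics on a closed connected `M` which is a
Ricci flow on `[s, t]`, `s < t`, and a Borel set `X` with `V_{h(s)}(X) > 0`, `V_{h(s)}(Xᶜ) > 0`,

  `|Φ⁻¹(ν_{x,t;s}(X)) − Φ⁻¹(ν_{x',t;s}(X))| ≤ (t − s)^{-1/2} · d_{h(t)}(x, x')`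

for all `x, x'` (extended form in `ℝ≥0∞`). Proof: the propagation `x ↦ ∫ 𝟙_X dν_{x,t;s} =
ν_{x,t;s}(X)` of the measurable datum `𝟙_X : M → [0, 1]` is either constant (then the left side
vanishes) or `Φ ∘ f'` with `f'` `(t − s)^{-1/2}`-Lipschitz
(`IsRicciFlow.integral_heatKernelMeasure_const_or_eq_Phi`), and `Φ⁻¹ ∘ Φ = id`.
[cite: Bamler2020Entropy, §4.1, Thm. 4.1] -/
theorem IsRicciFlow.ofReal_abs_PhiInv_heatKernelMeasure_real_sub_le {s t : ℝ} (hst : s < t)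
    (hflow : IsRicciFlow h cov (Icc s t)) {X : Set M} (hX : MeasurableSet X) (x x' : M) :
    ENNReal.ofReal |PhiInv ((heatKernelMeasure hh hR t x s).real X) -
        PhiInv ((heatKernelMeasure hh hR t x' s).real X)| ≤
      ENNReal.ofReal (1 / Real.sqrt (t - s)) * (h t).edist (hR t) x x' := by
  have hum : Measurable (X.indicator (1 : M → ℝ)) := measurable_one.indicator hX
  have hu01 : ∀ y, X.indicator (1 : M → ℝ) y ∈ Icc (0 : ℝ) 1 := fun y ↦ by
    by_cases hy : y ∈ X <;> simp [hy]
  have hint : ∀ z, ∫ w, X.indicator (1 : M → ℝ) w ∂(heatKernelMeasure hh hR t z s) =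
      (heatKernelMeasure hh hR t z s).real X := fun z ↦ integral_indicator_one hX
  rcases hflow.integral_heatKernelMeasure_const_or_eq_Phi hh hR hst hum hu01 with
    ⟨c, hc⟩ | ⟨f', hf', hf'eq⟩
  · -- constant propagation: the left side vanishes
    have e : (heatKernelMeasure hh hR t x s).real X = (heatKernelMeasure hh hR t x' s).real X := by
      rw [← hint x, ← hint x', hc x, hc x']
    rw [e, sub_self, abs_zero, ENNReal.ofReal_zero]
    exact bot_le
  · rw [← hint x, ← hint x', hf'eq x, hf'eq x', PhiInv_Phi, PhiInv_Phi]
    exact hf' x x'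

end IndicatorData

/-- **Bamler's improved gradient estimate (Thm. 4.1) for indicator data, in Lipschitz form, for a
Ricci flow on `[a, T]`.** Let `hflow = (h, cov)` be a Ricci flow on `[a, T]` of a `C^∞` family of
Riemannian metrics on a closed connected manifold `M`, `a < s < t ≤ T`, and `X ⊆ M` a Borel set
with `V_{h(s)}(X) > 0` and `V_{h(s)}(Xᶜ) > 0`. Then for all `x, x'`: `ν_{x,t;s}(X) ∈ (0, 1)` and

  `|Φ⁻¹(ν_{x,t;s}(X)) − Φ⁻¹(ν_{x',t;s}(X))| ≤ (t − s)^{-1/2} · d_{h(t)}(x, x')`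

(extended form in `ℝ≥0∞`) — the Literature brick behind Bamler 2020a, Prop. 4.2, (4.7)
`∫_X |∇ₓK(x,t;·,s)| dg_s ≤ (t − s)^{-1/2} Φ'(Φ⁻¹(ν_{x,t;s}(X)))`. Both facts only use the flow
on `[s, t]` (`IsRicciFlow.heatKernelMeasure_real_mem_Ioo`,
`IsRicciFlow.ofReal_abs_PhiInv_heatKernelMeasure_real_sub_le`).
[cite: Bamler2020Entropy, §4.3, (4.7)] -/
theorem ofReal_abs_PhiInv_heatKernelMeasure_sub_le {m : ℕ} {H : Type*} [TopologicalSpace H]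
    {I : ModelWithCorners ℝ (EuclideanSpace ℝ (Fin m)) H} [I.Boundaryless]
    {M : Type*} [TopologicalSpace M] [ChartedSpace H M] [IsManifold I ∞ M]
    [T2Space M] [CompactSpace M] [SecondCountableTopology M] [MeasurableSpace M] [BorelSpace M]
    [PreconnectedSpace M]
    {h : ℝ → PseudoRiemannianMetric I ∞ (EuclideanSpace ℝ (Fin m)) (TangentSpace I : M → Type _)}
    {cov : ℝ → CovariantDerivative I (EuclideanSpace ℝ (Fin m)) (TangentSpace I : M → Type _)}
    {a T : ℝ} (hflow : IsRicciFlow h cov (Icc a T)) (hh : IsContMDiffFamilyOn ∞ h univ)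
    (hR : ∀ r, (h r).IsRiemannian) {s t : ℝ} (has : a < s) (hst : s < t) (htT : t ≤ T)
    {X : Set M} (hX : MeasurableSet X) (hXpos : 0 < (h s).riemVolume X)
    (hXcpos : 0 < (h s).riemVolume Xᶜ) (x x' : M) :
    (heatKernelMeasure hh hR t x s).real X ∈ Ioo (0 : ℝ) 1 ∧
      ENNReal.ofReal |PhiInv ((heatKernelMeasure hh hR t x s).real X) -
          PhiInv ((heatKernelMeasure hh hR t x' s).real X)| ≤
        ENNReal.ofReal (1 / Real.sqrt (t - s)) * (h t).edist (hR t) x x' := by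
  have hflow' : IsRicciFlow h cov (Icc s t) := hflow.mono (Icc_subset_Icc has.le htT)
  exact ⟨hflow'.heatKernelMeasure_real_mem_Ioo hh hR hst hX hXpos hXcpos x,
    hflow'.ofReal_abs_PhiInv_heatKernelMeasure_real_sub_le hh hR hst hX x x'⟩

end Literature.Geometry.Riemannian
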